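import Literature.RingTheory.GradedAlgebra.QuotientGrading
import Mathlib.Analysis.Convex.SimplicialComplex.Basic
import Mathlib.RingTheory.MvPolynomial.Homogeneous
import Mathlib.RingTheory.MvPolynomial.Ideal
import Mathlib.AlgebraicGeometry.ProjectiveSpectrum.Functor
import HarnessLib

/-!
# Stanley–Reisner ideals, face rings and Stanley–Reisner schemes

Topic: `Literature/AlgebraicGeometry/StanleyReisner`. Let `K` be an abstract simplicial complex
on a vertex type `V` — Mathlib's `PreAbstractSimplicialComplex V`: a down-closed family of NONEMPTY
finite sets `K.faces : Set (Finset V)` (singletons need not be faces; the geometric complexes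
`Geometry.SimplicialComplex 𝕜 E` extend this structure, so everything below applies to them through
`K.toPreAbstractSimplicialComplex`) — and let `k` be a commutative ring.

* `stanleyReisnerIdeal k K ≤ k[x_v : v ∈ V]` (`MvPolynomial V k`) is the ideal generated by the
  squarefree monomials `x_S = ∏_{v ∈ S} x_v` of the NON-FACES `S` (nonempty `S ∉ K.faces`), and the
  **face ring** (Stanley–Reisner ring) is `FaceRing k K = k[x_V] ⧸ I_K`
  (Miller–Sturmfels, Def. 1.6; Stanley, *Combinatorics and Commutative Algebra*, II §1;
  Altmann–Christophersen 2009, §2.2: `I_𝒦 = ⟨x_p | p ∈ Δ_n ∖ 𝒦⟩`, `A_𝒦 = P / I_𝒦`).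
  Conventions: Mathlib's complexes carry no empty face, so "non-face" means a NONEMPTY non-member of
  `K.faces` — this is the usual ideal of the complex `K ∪ {∅}` (Miller–Sturmfels' "void complex",
  whose ideal would be `(1)`, is not representable, Def. 1.4); a vertex `v` with `{v} ∉ K.faces`
  contributes the generator `x_v` (Altmann–Christophersen allow this: the support `[𝒦]` may be
  smaller than `[n]`). `mem_stanleyReisnerIdeal_iff`: `f ∈ I_K` iff the support of every monomial
  of `f` is a non-face — the monomials `x^a` with `supp a ∈ K ∪ {∅}` form a `k`-basis of the face
  ring (Miller–Sturmfels, Thm. 1.7 and proof of Thm. 1.13); `prod_X_mem_stanleyReisnerIdeal_iff`,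
  `X_mem_stanleyReisnerIdeal_iff`, `stanleyReisnerIdeal_ne_top`.
* `I_K` is homogeneous for the standard grading (`isHomogeneous_stanleyReisnerIdeal`,
  `stanleyReisnerHomogeneousIdeal`), so the face ring is ℕ-graded:
  `faceRingGrading k K = quotGrading …` (`Literature/RingTheory/GradedAlgebra/QuotientGrading`).
* The **Stanley–Reisner schemes** (Altmann–Christophersen 2009, §2.2):
  `StanleyReisnerAffineScheme k K = 𝔸(K) = Spec A_K` and the projective
  `StanleyReisnerScheme k K = ℙ(K) = Proj A_K`, with its embedding
  `StanleyReisnerScheme.toProj : ℙ(K) ⟶ Proj k[x_V] = ℙ^{|V|-1}_k` (`Proj` of the graded quotient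
  map; a closed immersion by `Literature.AlgebraicGeometry.FundamentalGroup.
  isClosedImmersion_projMap_of_surjective`, not restated here). "ℙ(𝒦) looks like |𝒦| — its
  simplices have just been replaced by projective spaces" (loc. cit.).
* Re-indexing: `comap f K` pulls a complex back along an embedding of vertex types, and
  `onVertices K : AbstractSimplicialComplex (vertexSet K)` is `K` indexed by its own vertices
  `{v // {v} ∈ K.faces}` (all singletons faces) — the indexing used for a geometric complex
  `K' : Geometry.SimplicialComplex ℝ E`, whose ambient type `E` is not the vertex set
  (`stanleyReisnerIdeal_onVertices`).

Not here: Hochster's formula / Cohen–Macaulayness (Stanley II §4), the chart description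
`D₊(x_f) = 𝔸(lk f) × 𝔾ₘ^{dim f}` and the cotangent cohomology `T¹, T²` of face rings
(Altmann–Christophersen 2009, §2.2, Thm. 4.1/4.6 — their graded pieces are theorems about `Tⁱ`, not
definitions, and `Tⁱ` of a `k`-algebra is not in Mathlib); smoothings of `ℙ(K)` are phrased with
`Literature/AlgebraicGeometry/Deformation/FormalEmbeddedSmoothing`.

## References

* E. Miller, B. Sturmfels, *Combinatorial Commutative Algebra*, GTM 227 (2005): Def. 1.4, Def. 1.6,
  Thm. 1.7, Thm. 1.13. [MillerSturmfels2005]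
* K. Altmann, J. A. Christophersen, *Deforming Stanley–Reisner schemes*, Math. Ann. 348 (2010),
  arXiv:0901.2502: §2.1–2.2. [AltmannChristophersen2009]
* W. Bruns, J. Herzog, *Cohen–Macaulay rings* (1998), §5.1. [BrunsHerzog1998]
-/

noncomputable section

open MvPolynomial AlgebraicGeometry

attribute [local instance] MvPolynomial.gradedAlgebra

namespace Literature.AlgebraicGeometry.StanleyReisner

universe u v w

/-! ## Non-faces and re-indexing of abstract simplicial complexes -/

section Complex

variable {V : Type v} {W : Type w}

/-- The **non-faces** of `K`: nonempty finite vertex sets that are not faces. (The empty set is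
never a face of a Mathlib complex and is NOT counted as a non-face: it plays the empty face.)
[cite: MillerSturmfels2005, Def. 1.6] -/
def nonfaces (K : PreAbstractSimplicialComplex V) : Set (Finset V) :=
  {S | S.Nonempty ∧ S ∉ K.faces}

/-- Unfolding `nonfaces`. [folklore] -/
@[simp]
theorem mem_nonfaces {K : PreAbstractSimplicialComplex V} {S : Finset V} :
    S ∈ nonfaces K ↔ S.Nonempty ∧ S ∉ K.faces :=
  Iff.rfl

/-- Non-faces are up-closed (faces are down-closed). [folklore] -/
theorem mem_nonfaces_of_subset {K : PreAbstractSimplicialComplex V} {S T : Finset V}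
    (hS : S ∈ nonfaces K) (hST : S ⊆ T) : T ∈ nonfaces K :=
  ⟨hS.1.mono hST, fun hT => hS.2 ((K.isRelLowerSet_faces hT).2 hST hS.1)⟩

/-- The **vertex set** of an abstract complex: the `v` with `{v}` a face (Altmann–Christophersen's
support `[𝒦] = {i | {i} ∈ 𝒦}`; Mathlib's `Geometry.SimplicialComplex.vertices` for geometric
complexes). [cite: AltmannChristophersen2009, §2.1] -/
def vertexSet (K : PreAbstractSimplicialComplex V) : Set V :=
  {v | {v} ∈ K.faces}

/-- Unfolding `vertexSet`. [folklore] -/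
@[simp]
theorem mem_vertexSet {K : PreAbstractSimplicialComplex V} {v : V} :
    v ∈ vertexSet K ↔ ({v} : Finset V) ∈ K.faces :=
  Iff.rfl

/-- Every vertex of a face is a vertex of the complex. [folklore] -/
theorem mem_vertexSet_of_mem_faces {K : PreAbstractSimplicialComplex V} {S : Finset V}
    (hS : S ∈ K.faces) {v : V} (hv : v ∈ S) : v ∈ vertexSet K :=
  (K.isRelLowerSet_faces hS).2 (Finset.singleton_subset_iff.2 hv) (Finset.singleton_nonempty v)

/-- For a geometric complex `K : Geometry.SimplicialComplex 𝕜 E` the vertex set of the underlying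
abstract complex is Mathlib's `K.vertices` (`rfl`). [folklore] -/
theorem vertexSet_toPreAbstractSimplicialComplex {𝕜 E : Type*} [Ring 𝕜] [PartialOrder 𝕜]
    [AddCommGroup E] [Module 𝕜 E] (K : Geometry.SimplicialComplex 𝕜 E) :
    vertexSet K.toPreAbstractSimplicialComplex = K.vertices :=
  rfl

/-- Pull an abstract simplicial complex back along an embedding `f : W ↪ V` of vertex types: the
faces of `comap f K` are the `S` with `f(S)` a face of `K` (the full subcomplex on the image of
`f`, re-indexed by `W`). [folklore] -/
def comap (f : W ↪ V) (K : PreAbstractSimplicialComplex V) : PreAbstractSimplicialComplex W where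
  faces := {S | S.map f ∈ K.faces}
  isRelLowerSet_faces := by
    intro S hS
    refine ⟨Finset.map_nonempty.1 (K.isRelLowerSet_faces hS).1, fun T hTS hT => ?_⟩
    exact (K.isRelLowerSet_faces hS).2 (Finset.map_subset_map.2 hTS) (Finset.map_nonempty.2 hT)

/-- Unfolding `comap`: `S` is a face of `comap f K` iff `f(S)` is a face of `K`. [folklore] -/
@[simp]
theorem mem_comap_faces {f : W ↪ V} {K : PreAbstractSimplicialComplex V} {S : Finset W} :
    S ∈ (comap f K).faces ↔ S.map f ∈ K.faces :=
  Iff.rfl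

/-- **`K` indexed by its own vertex set**: the complex on the type `vertexSet K = {v // {v} ∈ K}`
whose faces are the `S` with `↑S ∈ K.faces`; all singletons are faces, so this is an
`AbstractSimplicialComplex`. For a geometric complex `K' : Geometry.SimplicialComplex ℝ E` this is
the finite-type indexing of the face ring (variables = vertices, not all of `E`). [folklore] -/
def onVertices (K : PreAbstractSimplicialComplex V) : AbstractSimplicialComplex (vertexSet K) :=
  (comap (Function.Embedding.subtype _) K).toAbstractSimplicialComplex _ fun v => by
    rw [mem_comap_faces, Finset.map_singleton]
    exact v.2

/-- Unfolding `onVertices`: `S` is a face iff its image in `V` is a face of `K`. [folklore] -/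
@[simp]
theorem mem_onVertices_faces {K : PreAbstractSimplicialComplex V} {S : Finset (vertexSet K)} :
    S ∈ (onVertices K).faces ↔ S.map (Function.Embedding.subtype _) ∈ K.faces :=
  Iff.rfl

/-- Every face of `K` is (the image of) a face of `onVertices K`. [folklore] -/
theorem exists_map_eq_of_mem_faces {K : PreAbstractSimplicialComplex V} {S : Finset V}
    (hS : S ∈ K.faces) :
    ∃ T ∈ (onVertices K).faces, T.map (Function.Embedding.subtype _) = S := by
  classical
  refine ⟨S.subtype (· ∈ vertexSet K), ?_, ?_⟩
  · rw [mem_onVertices_faces, Finset.subtype_map]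
    rwa [Finset.filter_true_of_mem fun v hv => mem_vertexSet_of_mem_faces hS hv]
  · rw [Finset.subtype_map, Finset.filter_true_of_mem fun v hv => mem_vertexSet_of_mem_faces hS hv]

end Complex

/-! ## The Stanley–Reisner ideal and the face ring -/

section Ideal

variable (k : Type u) [CommRing k] {V : Type v} (K : PreAbstractSimplicialComplex V)

/-- The **Stanley–Reisner ideal** `I_K ≤ k[x_v : v ∈ V]`: generated by the squarefree monomials
`x_S = ∏_{v ∈ S} x_v` of the non-faces `S` of `K` (nonempty `S ∉ K.faces`).
[cite: MillerSturmfels2005, Def. 1.6] -/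
def stanleyReisnerIdeal : Ideal (MvPolynomial V k) :=
  Ideal.span {m | ∃ S : Finset V, S.Nonempty ∧ S ∉ K.faces ∧ m = ∏ v ∈ S, X v}

/-- The squarefree monomial of a non-face lies in the Stanley–Reisner ideal. [folklore] -/
theorem prod_X_mem_stanleyReisnerIdeal {S : Finset V} (hS : S.Nonempty) (hSK : S ∉ K.faces) :
    ∏ v ∈ S, (X v : MvPolynomial V k) ∈ stanleyReisnerIdeal k K :=
  Ideal.subset_span ⟨S, hS, hSK, rfl⟩

/-- The Stanley–Reisner ideal is ANTITONE in the complex: more faces, fewer generators.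
[folklore] -/
theorem stanleyReisnerIdeal_anti {K L : PreAbstractSimplicialComplex V} (h : K ≤ L) :
    stanleyReisnerIdeal k L ≤ stanleyReisnerIdeal k K := by
  refine Ideal.span_mono ?_
  rintro m ⟨S, hS, hSL, rfl⟩
  exact ⟨S, hS, fun hSK => hSL (h hSK), rfl⟩

/-- `x_S = ∏_{v ∈ S} x_v` is the monomial with exponent the indicator vector of `S`. [folklore] -/
theorem prod_X_eq_monomial_indicator (S : Finset V) :
    ∏ v ∈ S, (X v : MvPolynomial V k) = monomial (Finsupp.indicator S fun _ _ => 1) 1 := by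
  have h := prod_X_pow (R := k) (fun _ : V => 1) S
  simpa only [pow_one] using h

/-- The indicator vector of `S` has support `S`. [folklore] -/
theorem support_indicator_one (S : Finset V) :
    (Finsupp.indicator S fun _ _ => (1 : ℕ)).support = S := by
  classical
  refine (Finsupp.support_indicator_subset _ _).antisymm fun v hv => ?_
  rw [Finsupp.mem_support_iff, Finsupp.indicator_apply, dif_pos hv]
  exact one_ne_zero

/-- `𝟙_S ≤ a` (as exponent vectors) iff `S ⊆ supp a`, i.e. `x_S ∣ x^a`. [folklore] -/
theorem indicator_one_le_iff {S : Finset V} {a : V →₀ ℕ} :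
    (Finsupp.indicator S fun _ _ => (1 : ℕ)) ≤ a ↔ S ⊆ a.support := by
  classical
  rw [Finsupp.le_def]
  constructor
  · intro h v hv
    have h1 := h v
    rw [Finsupp.indicator_apply, dif_pos hv] at h1
    exact Finsupp.mem_support_iff.2 (by omega)
  · intro h v
    rw [Finsupp.indicator_apply]
    split_ifs with hv
    · exact Nat.one_le_iff_ne_zero.2 (Finsupp.mem_support_iff.1 (h hv))
    · exact Nat.zero_le _

/-- The Stanley–Reisner ideal as a monomial ideal in Mathlib's format
(`MvPolynomial.mem_ideal_span_monomial_image`): spanned by the `monomial e 1`, `e` the indicator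
vector of a non-face. [folklore] -/
theorem stanleyReisnerIdeal_eq_span_monomial :
    stanleyReisnerIdeal k K = Ideal.span ((fun e => monomial e (1 : k)) ''
      {e | ∃ S ∈ nonfaces K, e = Finsupp.indicator S fun _ _ => 1}) := by
  unfold stanleyReisnerIdeal
  congr 1
  ext m
  constructor
  · rintro ⟨S, hS, hSK, rfl⟩
    exact ⟨_, ⟨S, ⟨hS, hSK⟩, rfl⟩, (prod_X_eq_monomial_indicator k S).symm⟩
  · rintro ⟨e, ⟨S, hS, rfl⟩, rfl⟩
    exact ⟨S, hS.1, hS.2, (prod_X_eq_monomial_indicator k S).symm⟩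

/-- **Membership in the Stanley–Reisner ideal is read off the monomials**: `f ∈ I_K` iff the
support of every monomial occurring in `f` is a non-face. Equivalently the monomials `x^a` with
`supp a` a face or empty form a `k`-basis of the face ring.
[cite: MillerSturmfels2005, Thm. 1.7] -/
theorem mem_stanleyReisnerIdeal_iff {f : MvPolynomial V k} :
    f ∈ stanleyReisnerIdeal k K ↔ ∀ a ∈ f.support, a.support ∈ nonfaces K := by
  rw [stanleyReisnerIdeal_eq_span_monomial, mem_ideal_span_monomial_image]
  refine forall₂_congr fun a _ => ⟨?_, ?_⟩
  · rintro ⟨e, ⟨S, hS, rfl⟩, hle⟩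
    exact mem_nonfaces_of_subset hS (indicator_one_le_iff.1 hle)
  · intro ha
    exact ⟨_, ⟨a.support, ha, rfl⟩, indicator_one_le_iff.2 subset_rfl⟩

/-- A monomial `c · x^a`, `c ≠ 0`, lies in `I_K` iff `supp a` is a non-face. [folklore] -/
theorem monomial_mem_stanleyReisnerIdeal_iff {a : V →₀ ℕ} {c : k} (hc : c ≠ 0) :
    monomial a c ∈ stanleyReisnerIdeal k K ↔ a.support ∈ nonfaces K := by
  classical
  rw [mem_stanleyReisnerIdeal_iff, support_monomial, if_neg hc]
  simp

/-- Over a nontrivial ring, `x_S ∈ I_K` iff `S` is not a face (`S` nonempty).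
[cite: MillerSturmfels2005, Thm. 1.7] -/
theorem prod_X_mem_stanleyReisnerIdeal_iff [Nontrivial k] {S : Finset V} (hS : S.Nonempty) :
    ∏ v ∈ S, (X v : MvPolynomial V k) ∈ stanleyReisnerIdeal k K ↔ S ∉ K.faces := by
  rw [prod_X_eq_monomial_indicator, monomial_mem_stanleyReisnerIdeal_iff k K one_ne_zero,
    support_indicator_one, mem_nonfaces]
  exact ⟨fun h => h.2, fun h => ⟨hS, h⟩⟩

/-- Over a nontrivial ring, `x_v ∈ I_K` iff `v` is not a vertex of `K`. [folklore] -/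
theorem X_mem_stanleyReisnerIdeal_iff [Nontrivial k] (v : V) :
    (X v : MvPolynomial V k) ∈ stanleyReisnerIdeal k K ↔ ({v} : Finset V) ∉ K.faces := by
  rw [← prod_X_mem_stanleyReisnerIdeal_iff k K (Finset.singleton_nonempty v),
    Finset.prod_singleton]

/-- The Stanley–Reisner ideal is a proper ideal (over a nontrivial ring): `1 = x^0` and `supp 0 = ∅`
is not a non-face. [folklore] -/
theorem stanleyReisnerIdeal_ne_top [Nontrivial k] : stanleyReisnerIdeal k K ≠ ⊤ := by
  rw [Ne, Ideal.eq_top_iff_one, ← C_1, ← monomial_zero',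
    monomial_mem_stanleyReisnerIdeal_iff k K one_ne_zero, Finsupp.support_zero, mem_nonfaces]
  exact fun h => Finset.not_nonempty_empty h.1

/-- No nonzero constant lies in `I_K`. [folklore] -/
theorem C_mem_stanleyReisnerIdeal_iff {c : k} :
    (C c : MvPolynomial V k) ∈ stanleyReisnerIdeal k K ↔ c = 0 := by
  refine ⟨fun h => ?_, fun h => by simp [h]⟩
  by_contra hc
  rw [← monomial_zero', monomial_mem_stanleyReisnerIdeal_iff k K hc, Finsupp.support_zero,
    mem_nonfaces] at h
  exact Finset.not_nonempty_empty h.1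

/-- The generators `x_S` are homogeneous (of degree `|S|`), so **`I_K` is a homogeneous ideal** for
the standard grading of `k[x_V]`. [folklore] -/
theorem isHomogeneous_stanleyReisnerIdeal :
    (stanleyReisnerIdeal k K).IsHomogeneous (homogeneousSubmodule V k) := by
  refine Ideal.homogeneous_span _ _ ?_
  rintro m ⟨S, -, -, rfl⟩
  refine ⟨∑ v ∈ S, 1, (mem_homogeneousSubmodule _ _).2 ?_⟩
  exact IsHomogeneous.prod S (fun v => X v) (fun _ => 1) fun v _ => isHomogeneous_X k v

/-- The Stanley–Reisner ideal as a homogeneous ideal of the graded ring `k[x_V]`. [folklore] -/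
def stanleyReisnerHomogeneousIdeal : HomogeneousIdeal (homogeneousSubmodule V k) :=
  ⟨stanleyReisnerIdeal k K, isHomogeneous_stanleyReisnerIdeal k K⟩

/-- The underlying ideal of `stanleyReisnerHomogeneousIdeal` is `stanleyReisnerIdeal` (`rfl`).
[folklore] -/
@[simp]
theorem toIdeal_stanleyReisnerHomogeneousIdeal :
    (stanleyReisnerHomogeneousIdeal k K).toIdeal = stanleyReisnerIdeal k K :=
  rfl

/-- The Stanley–Reisner ideal of `K` re-indexed by its vertices: generated by the `x_S`,
`S` a nonempty finite set of vertices whose image in `V` is not a face — the form in which the ideal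
of a geometric complex is usually written. [folklore] -/
theorem stanleyReisnerIdeal_onVertices (K : PreAbstractSimplicialComplex V) :
    stanleyReisnerIdeal k (onVertices K).toPreAbstractSimplicialComplex =
      Ideal.span {m | ∃ S : Finset (vertexSet K), S.Nonempty ∧
        S.map (Function.Embedding.subtype _) ∉ K.faces ∧ m = ∏ v ∈ S, X v} :=
  rfl

/-- The **face ring** (Stanley–Reisner ring) `A_K = k[x_v : v ∈ V] ⧸ I_K`.
[cite: MillerSturmfels2005, Def. 1.6] -/
abbrev FaceRing : Type (max u v) :=
  MvPolynomial V k ⧸ stanleyReisnerIdeal k K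

/-- The face ring of a complex is nontrivial (over a nontrivial ring). [folklore] -/
instance FaceRing.nontrivial [Nontrivial k] : Nontrivial (FaceRing k K) :=
  Ideal.Quotient.nontrivial_iff.2 (stanleyReisnerIdeal_ne_top k K)

/-- The **ℕ-grading of the face ring** by degree: `(A_K)_n` is the image of the degree-`n` forms
(`Literature.RingTheory.GradedAlgebra.quotGrading` of the homogeneous ideal `I_K`). [folklore] -/
abbrev faceRingGrading : ℕ → Submodule k (FaceRing k K) :=
  Literature.RingTheory.GradedAlgebra.quotGrading (homogeneousSubmodule V k)
    (stanleyReisnerHomogeneousIdeal k K).toIdeal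

/-- The face ring is a graded `k`-algebra. [folklore] -/
instance faceRingGrading.gradedAlgebra : GradedAlgebra (faceRingGrading k K) :=
  Literature.RingTheory.GradedAlgebra.quotGrading.gradedAlgebra _ _

/-- The quotient map `k[x_V] → A_K` as a graded ring homomorphism. [folklore] -/
abbrev FaceRing.mkGraded : homogeneousSubmodule V k →+*ᵍ faceRingGrading k K :=
  Literature.RingTheory.GradedAlgebra.quotGradedHom (homogeneousSubmodule V k)
    (stanleyReisnerHomogeneousIdeal k K).toIdeal

end Ideal

/-! ## The Stanley–Reisner schemes `𝔸(K) = Spec A_K` and `ℙ(K) = Proj A_K` -/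

section Scheme

variable (k : Type u) [CommRing k] {V : Type v} (K : PreAbstractSimplicialComplex V)

/-- The **affine Stanley–Reisner scheme** `𝔸(K) = Spec A_K` — the union of the coordinate
subspaces `𝔸^S ⊆ 𝔸^V` spanned by the faces `S` of `K`. [cite: AltmannChristophersen2009, §2.2] -/
def StanleyReisnerAffineScheme : Scheme.{max u v} :=
  Spec (CommRingCat.of (FaceRing k K))

/-- The **(projective) Stanley–Reisner scheme** `ℙ(K) = Proj A_K` of the complex `K` over `k`:
`Proj` of the face ring with its grading by degree — "it looks like `|K|`, its simplices have just
been replaced by projective spaces". [cite: AltmannChristophersen2009, §2.2] -/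
def StanleyReisnerScheme : Scheme.{max u v} :=
  Proj (faceRingGrading k K)

/-- The embedding `ℙ(K) ⟶ Proj k[x_v : v ∈ V] = ℙ_k^{|V|-1}` cutting `ℙ(K)` out by `I_K`: `Proj`
of the graded surjection `k[x_V] → A_K` (Mathlib `Proj.map`; a closed immersion, cf.
`Literature.AlgebraicGeometry.FundamentalGroup.isClosedImmersion_projMap_of_surjective`).
[cite: AltmannChristophersen2009, §2.2] -/
def StanleyReisnerScheme.toProj :
    StanleyReisnerScheme k K ⟶ Proj (homogeneousSubmodule V k) :=
  Proj.map (FaceRing.mkGraded k K)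
    (Literature.RingTheory.GradedAlgebra.irrelevant_quotGrading_le_map _ _)

/-- The structure morphism `ℙ(K) ⟶ Spec (A_K)₀` to the degree-zero part (Mathlib
`Proj.toSpecZero`); `(A_K)₀ = k` as no nonzero constant lies in `I_K`
(`C_mem_stanleyReisnerIdeal_iff`). [folklore] -/
def StanleyReisnerScheme.toSpecZero :
    StanleyReisnerScheme k K ⟶ Spec (CommRingCat.of (faceRingGrading k K 0)) :=
  Proj.toSpecZero (faceRingGrading k K)

end Scheme

end Literature.AlgebraicGeometry.StanleyReisner
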